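import Summits.ResolutionOfSingularities.ResolutionOfSingularities.Theorems.FrobeniusClosingSteerSigmaTopLegality
import Literature.AlgebraicGeometry.Resolution.LocalBlowup
import Literature.AlgebraicGeometry.Resolution.QuadraticTransforms
import HarnessLib

/-!
# Crux `Steer` (stmt-ResolutionOfSingularities-16345), chain W4.1: σ_top LEGALITY BRICKS for the F-B / F-A1 side,
# part 2 of 2 — the centre FOREST across a point step: (L2) births are cheap, (L3) the converse side,
# (L4) the exceptional-parameter dichotomy (Theses-free research support)

OURS (campaign `res-hironaka`, rung L ★L-G4, slot W4.1; statements about the route's own objects; they replace the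
role of no printed item and are NOT statements of the manuscript under review [claim: Hironaka2017, status:
under-review]; AI review is weaker than expert review). Object of res-L0-w41-plan-1 RULING 52 (g9)
(HOME/STATUS 2026-08-27T09:38:21Z) for seat res-D-pv-004 (AS res-L0-w41-stub-10). The words `IsPointStep`,
`IsPosStep`, `IsAncestorStep`, `IsRootStep`, `HasInfiniteBirths` are those of part 1
(`FrobeniusClosingSteerSigmaTopLegality.lean`, VERBATIM `Steer_r31.lean` 727d9e199382098a / r32 6ccdb6edb3c7f9c9).

## (L2) Births are cheap (§2; res-L0-w41-tri-3's `Scratch-g4.lean` 811275e28cc36248 statements, re-proved here)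

`isRootStep_of_comap_eq_maximalIdeal` (a positive step whose centre contracts to the closed point of every earlier
member is a ROOT — heights play no role), `comap_eq_maximalIdeal_of_isPointStep` (over the centre of a POINT step
the contraction is the closed point), `isRootStep_succ_of_comap_eq_maximalIdeal` / `isRootStep_succ_of_isPointStep`
(tower form: `R i` dominating the earlier members, a point step at `i`, a positive step at `i+1` whose prime centre
lies over `P i` ⇒ `IsRootStep R P (i+1)`), and two NEW corollaries: `not_isAncestorStep_of_comap_eq_maximalIdeal`
(if the centre of ANY later stage `j > i` contracts to `𝔪_i` then `j` has NO ancestor `≤ i`) and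
`hasInfiniteBirths_of_frequently` (infinitely many «positive step right over a point step» ⇒ `HasInfiniteBirths`;
res-L0-w41-plan-1 RULING 23b in the kernel). §2b discharges the domination hypothesis `hdom` of these lemmas on every run of
local blowings up with respect to `O` from a member dominated by `O` (`comap_maximalIdeal_eq_of_subringDominates`,
`hdom_of_dominated_by`, `subringDominates_of_isLocalBlowup`, `isRootStep_succ_of_isPointStep_of_isLocalBlowup`).

## (L3) The converse side (§3; res-L0-w41-plan-1 RULING 40 Q1)

Ancestor relations CAN straddle a point step: for a point step at `i` (the local blowing up of `R i` along `𝔪_i`,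
tree `IsLocalBlowupAlong`, whose exceptional parameter `x_i` has `𝔪_i ⊆ x_i · R (i+1)`,
`IsLocalBlowupAlong.exists_span_singleton`) and ANY ideal `Q` of a later member `R' ⊇ R (i+1)`:
`Q ∩ R i = 𝔪_i ⟺ x_i ∈ Q` for `Q` prime (`comap_eq_maximalIdeal_iff_mem`,
`exists_excParam_comap_eq_maximalIdeal_iff[_run]`), so `x_i ∉ P j ⟹ P j ∩ R i ≠ 𝔪_i` is a prime STRICTLY BELOW
`𝔪_i` (`comap_ne_maximalIdeal_of_not_mem`, `comap_lt_maximalIdeal_of_not_mem`,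
`comap_ne_maximalIdeal_of_excParam_not_mem`).

## (L4) Synthesis (§4)

The ancestors `≤ i` of a later positive step `j` die EXACTLY when `x_i ∈ P j`: `not_isAncestorStep_of_excParam_mem`,
`isRootStep_succ_of_excParam_mem` (a positive step at `i+1` with `x_i ∈ P (i+1)` is a BIRTH), and the packaged
`excParam_dichotomy` over `IsLocalBlowupAlong` (for every `j > i`: `x_i ∈ P j` and no ancestor `≤ i`, or `x_i ∉ P j` and
`P j ∩ R i` is a prime strictly below `𝔪_i`).

No Theses file is imported; nothing here is a route item or a registration. [cite: NovacoskiSpivakovsky2014, Def. 2.8, Def. 2.11]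
[cite: Cutkosky2014, §2.1]
-/

noncomputable section

-- `Summit.<S>.<S>.…` duplicates the summit name by design (single-problem summit).
set_option linter.dupNamespace false

open IsLocalRing

namespace Summit.ResolutionOfSingularities.ResolutionOfSingularities.Theorems.SwitchingDichotomy.SigmaTopLegality

open Literature.AlgebraicGeometry.Resolution

variable {K : Type} [Field K]

/-! ## §2 (L2) Births are cheap (res-L0-w41-tri-3 `Scratch-g4.lean` 811275e28cc36248, re-proved in the tree) -/

section L2

/-- A positive step whose centre contracts to the maximal ideal of every earlier member is a ROOT (birth): an
ancestor `i` would have `P i = 𝔪_i`, contradicting the positivity of `i`.  Heights are not used. OURS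
(res-L0-w41-tri-3). [folklore] -/
theorem isRootStep_of_comap_eq_maximalIdeal (R : ℕ → Subring K) (P : (i : ℕ) → Ideal (R i))
    [∀ i, IsLocalRing (R i)] (j : ℕ) (hpos : IsPosStep R P j)
    (hmax : ∀ i, i < j → ∀ h : R i ≤ R j,
      Ideal.comap (Subring.inclusion h) (P j) = maximalIdeal (R i)) :
    IsRootStep R P j := by
  refine ⟨hpos, fun i hanc => ?_⟩
  obtain ⟨hij, ⟨_, hne⟩, -, -, h, hc⟩ := hanc
  exact hne (hc.symm.trans (hmax i hij h))

/-- Over the centre of a POINT step the contraction is the closed point: if stage `i` is a point step and the centre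
of stage `i+1` lies over `P i` (e.g. it contains the exceptional parameter), then it contracts to `𝔪_i`. OURS
(res-L0-w41-tri-3). [folklore] -/
theorem comap_eq_maximalIdeal_of_isPointStep (R : ℕ → Subring K) (P : (i : ℕ) → Ideal (R i))
    [∀ i, IsLocalRing (R i)] (i : ℕ) (hpt : IsPointStep R P i) (h : R i ≤ R (i + 1))
    [hprime : (P (i + 1)).IsPrime] (hover : (P i).map (Subring.inclusion h) ≤ P (i + 1)) :
    Ideal.comap (Subring.inclusion h) (P (i + 1)) = maximalIdeal (R i) := by
  obtain ⟨_, hPi⟩ := hpt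
  have h1 : maximalIdeal (R i) ≤ Ideal.comap (Subring.inclusion h) (P (i + 1)) := by
    rw [← hPi]; exact Ideal.map_le_iff_le_comap.mp hover
  exact ((IsLocalRing.maximalIdeal.isMaximal (R i)).eq_of_le
    (Ideal.comap_ne_top _ hprime.ne_top) h1).symm

/-- TOWER FORM (the shape used on a steered run): members local, `R i` dominating every member below it, stage
`i+1` positive with centre contracting to `𝔪_i` ⇒ stage `i+1` is a ROOT. OURS (res-L0-w41-tri-3). [folklore] -/
theorem isRootStep_succ_of_comap_eq_maximalIdeal (R : ℕ → Subring K) (P : (i : ℕ) → Ideal (R i))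
    [∀ i, IsLocalRing (R i)] (hmono : Monotone R) (i : ℕ)
    (hdom : ∀ i' (e : R i' ≤ R i), Ideal.comap (Subring.inclusion e) (maximalIdeal (R i)) = maximalIdeal (R i'))
    (hpos : IsPosStep R P (i + 1))
    (hE : Ideal.comap (Subring.inclusion (hmono (Nat.le_succ i))) (P (i + 1)) = maximalIdeal (R i)) :
    IsRootStep R P (i + 1) := by
  refine isRootStep_of_comap_eq_maximalIdeal R P (i + 1) hpos fun i' hi' h => ?_
  have e₁ : R i' ≤ R i := hmono (Nat.lt_succ_iff.mp hi')
  have hcomp : Subring.inclusion h =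
      (Subring.inclusion (hmono (Nat.le_succ i))).comp (Subring.inclusion e₁) :=
    RingHom.ext fun _ => rfl
  rw [hcomp, ← Ideal.comap_comap, hE, hdom i' e₁]

/-- COROLLARY in the words of a run: a point step at stage `i`, a positive step at stage `i+1` whose (prime) centre
lies over `P i`, `R i` dominating all earlier members ⇒ `IsRootStep R P (i+1)`. OURS (res-L0-w41-tri-3). [folklore] -/
theorem isRootStep_succ_of_isPointStep (R : ℕ → Subring K) (P : (i : ℕ) → Ideal (R i))
    [∀ i, IsLocalRing (R i)] (hmono : Monotone R) (i : ℕ)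
    (hdom : ∀ i' (e : R i' ≤ R i), Ideal.comap (Subring.inclusion e) (maximalIdeal (R i)) = maximalIdeal (R i'))
    (hpt : IsPointStep R P i) (hpos : IsPosStep R P (i + 1)) [(P (i + 1)).IsPrime]
    (hover : (P i).map (Subring.inclusion (hmono (Nat.le_succ i))) ≤ P (i + 1)) :
    IsRootStep R P (i + 1) :=
  isRootStep_succ_of_comap_eq_maximalIdeal R P hmono i hdom hpos
    (comap_eq_maximalIdeal_of_isPointStep R P i hpt _ hover)

/-- **(L2, any later stage)** If the centre of SOME later stage `j > i` contracts to the closed point `𝔪_i` of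
`R i` (for a point step at `i`: iff it contains the exceptional parameter `x_i`, §3), and `R i` dominates every
earlier member, then `j` has NO ancestor at or before `i`: an ancestor `i' ≤ i` would have
`P i' = P j ∩ R i' = 𝔪_i ∩ R i' = 𝔪_{i'}`, contradicting the positivity of `i'`. OURS. [folklore] -/
theorem not_isAncestorStep_of_comap_eq_maximalIdeal (R : ℕ → Subring K) (P : (i : ℕ) → Ideal (R i))
    [∀ i, IsLocalRing (R i)] {i j : ℕ} (hij : R i ≤ R j)
    (hdom : ∀ i' (e : R i' ≤ R i), Ideal.comap (Subring.inclusion e) (maximalIdeal (R i)) = maximalIdeal (R i'))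
    (hE : Ideal.comap (Subring.inclusion hij) (P j) = maximalIdeal (R i)) {i' : ℕ} (hi' : R i' ≤ R i) :
    ¬ IsAncestorStep R P i' j := by
  rintro ⟨-, ⟨_, hne⟩, -, -, h, hc⟩
  have hcomp : Subring.inclusion h = (Subring.inclusion hij).comp (Subring.inclusion hi') :=
    RingHom.ext fun _ => rfl
  rw [hcomp, ← Ideal.comap_comap, hE, hdom i' hi'] at hc
  exact hne hc.symm

/-- **(L2e) = res-L0-w41-plan-1 RULING 23b in the kernel**: on a monotone tower of local members, each dominating
the earlier ones, if for infinitely many stages `i` the step at `i` is a POINT step and the step at `i+1` is a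
POSITIVE step whose prime centre lies over `P i` (every stripping of the fresh exceptional divisor of a point step,
indeed every positive step taken inside that divisor), then the run has INFINITELY MANY BIRTHS. OURS. [folklore] -/
theorem hasInfiniteBirths_of_frequently (R : ℕ → Subring K) (P : (i : ℕ) → Ideal (R i))
    [∀ i, IsLocalRing (R i)] (hmono : Monotone R)
    (hdom : ∀ i i' (e : R i' ≤ R i),
      Ideal.comap (Subring.inclusion e) (maximalIdeal (R i)) = maximalIdeal (R i'))
    (h : ∀ N, ∃ i, N ≤ i ∧ IsPointStep R P i ∧ IsPosStep R P (i + 1) ∧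
      ∃ _ : (P (i + 1)).IsPrime, (P i).map (Subring.inclusion (hmono (Nat.le_succ i))) ≤ P (i + 1)) :
    HasInfiniteBirths R P := by
  refine Set.infinite_of_not_bddAbove ?_
  rw [not_bddAbove_iff]
  intro N
  obtain ⟨i, hNi, hpt, hpos, hprime, hover⟩ := h N
  haveI := hprime
  exact ⟨i + 1, isRootStep_succ_of_isPointStep R P hmono i (hdom i) hpt hpos hover, by omega⟩

end L2

/-! ## §2b Domination along the run discharges `hdom` (tree `SubringDominates`, `locAtCentre`) -/

section Domination

/-- If the local member `S` DOMINATES the local member `R` (tree `SubringDominates R S`: `R ≤ S` and every element of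
`R` invertible in `S` is invertible in `R`), then `𝔪_S ∩ R = 𝔪_R`. (Bridge from the tree's instance-free domination
to the `comap` form used by the forest lemmas.) [cite: Cutkosky2014, §2.1] -/
theorem comap_maximalIdeal_eq_of_subringDominates (R S : Subring K) [IsLocalRing R] [IsLocalRing S]
    (h : SubringDominates R S) :
    Ideal.comap (Subring.inclusion h.1) (maximalIdeal S) = maximalIdeal R := by
  refine ((IsLocalRing.maximalIdeal.isMaximal R).eq_of_le
    (Ideal.comap_ne_top _ (Ideal.IsPrime.ne_top inferInstance)) fun x hx => ?_).symm
  rw [Ideal.mem_comap, mem_maximalIdeal_iff_inv_not_mem, Subring.coe_inclusion]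
  rcases (mem_maximalIdeal_iff_inv_not_mem x).mp hx with h0 | hinv
  · exact Or.inl h0
  · exact Or.inr fun hS => hinv (h.2 (x : K) x.2 hS)

/-- Two local members `R' ≤ R''` both dominated by the valuation ring `O` dominate one another: `𝔪_{R''} ∩ R' = 𝔪_{R'}`.
[cite: Cutkosky2014, §2.1] -/
theorem comap_maximalIdeal_eq_of_dominated_by (O : ValuationSubring K) (R' R'' : Subring K)
    [IsLocalRing R'] [IsLocalRing R''] (h' : SubringDominates R' O.toSubring)
    (h'' : SubringDominates R'' O.toSubring) (e : R' ≤ R'') :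
    Ideal.comap (Subring.inclusion e) (maximalIdeal R'') = maximalIdeal R' :=
  comap_maximalIdeal_eq_of_subringDominates R' R'' (h'.of_le_of_le e h''.1)

/-- **The `hdom` hypothesis of §2 on a run dominated by `O`**: if every member `R i` is dominated by `O` (e.g. each is
a localisation at the centre of `O`, `subringDominates_locAtCentre`; or use `subringDominates_of_isLocalBlowup`), then
`𝔪_i ∩ R i' = 𝔪_{i'}` for EVERY pair with `R i' ≤ R i` (no order on the indices needed). OURS. [folklore] -/
theorem hdom_of_dominated_by (O : ValuationSubring K) (R : ℕ → Subring K) [∀ i, IsLocalRing (R i)]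
    (hO : ∀ i, SubringDominates (R i) O.toSubring) (i i' : ℕ) (e : R i' ≤ R i) :
    Ideal.comap (Subring.inclusion e) (maximalIdeal (R i)) = maximalIdeal (R i') :=
  comap_maximalIdeal_eq_of_dominated_by O (R i') (R i) (hO i') (hO i) e

/-- The members of a sequence of LOCAL BLOWINGS UP with respect to `O` (tree `IsLocalBlowup`; in particular of a
σ_top-steered run, `IsLocalBlowupAlong.isLocalBlowup`) starting from a member dominated by `O` are all dominated by
`O`. [cite: NovacoskiSpivakovsky2014, Def. 2.8] -/
theorem subringDominates_of_isLocalBlowup (O : ValuationSubring K) (R : ℕ → Subring K)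
    (h0 : SubringDominates (R 0) O.toSubring) (hbl : ∀ i, IsLocalBlowup O (R i) (R (i + 1))) (i : ℕ) :
    SubringDominates (R i) O.toSubring := by
  induction i with
  | zero => exact h0
  | succ i _ =>
    obtain ⟨hB, t, ht, e⟩ := hbl i
    rw [e]
    exact subringDominates_locAtCentre (Subring.closure_le.mpr (Set.union_subset hB ht))

/-- **(L2) on a steered run, hypothesis-free form**: members local, `R 0` dominated by `O`, every step a local blowing
up with respect to `O`; a POINT step at `i` and a POSITIVE step at `i+1` whose prime centre lies over `P i` ⇒ stage
`i+1` is a BIRTH. OURS. [folklore] -/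
theorem isRootStep_succ_of_isPointStep_of_isLocalBlowup (O : ValuationSubring K) (R : ℕ → Subring K)
    (P : (i : ℕ) → Ideal (R i)) [∀ i, IsLocalRing (R i)] (h0 : SubringDominates (R 0) O.toSubring)
    (hbl : ∀ i, IsLocalBlowup O (R i) (R (i + 1))) (i : ℕ) (hpt : IsPointStep R P i)
    (hpos : IsPosStep R P (i + 1)) [(P (i + 1)).IsPrime]
    (hover : (P i).map (Subring.inclusion (hbl i).le) ≤ P (i + 1)) :
    IsRootStep R P (i + 1) :=
  have hmono : Monotone R := monotone_nat_of_le_succ fun n => (hbl n).le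
  isRootStep_succ_of_isPointStep R P hmono i
    (fun i' e => hdom_of_dominated_by O R (subringDominates_of_isLocalBlowup O R h0 hbl) i i' e) hpt hpos hover

end Domination

/-! ## §3 (L3) The converse side: a later centre contracts to the closed point of a point-step member iff it
contains the exceptional parameter (res-L0-w41-plan-1 RULING 40 Q1) -/

section L3

/-- **(L3a)** If an element `x` of the maximal ideal of a local member `R` does NOT lie in an ideal `Q` of a later
member `R' ⊇ R`, then `Q ∩ R ≠ 𝔪_R` (for `Q` prime: `Q ∩ R` is a NON-maximal prime of `R`). OURS. [folklore] -/
theorem comap_ne_maximalIdeal_of_not_mem (R R' : Subring K) [IsLocalRing R] (h : R ≤ R') (Q : Ideal R')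
    (x : R) (hx : x ∈ maximalIdeal R) (hxQ : Subring.inclusion h x ∉ Q) :
    Ideal.comap (Subring.inclusion h) Q ≠ maximalIdeal R := by
  intro he
  rw [← he, Ideal.mem_comap] at hx
  exact hxQ hx

/-- **(L3a′)** For a PRIME `Q` of the later member the contraction `Q ∩ R` missing an element of `𝔪_R` is a prime
STRICTLY BELOW `𝔪_R` (a non-maximal prime of the local member `R`). OURS. [folklore] -/
theorem comap_lt_maximalIdeal_of_not_mem (R R' : Subring K) [IsLocalRing R] (h : R ≤ R') (Q : Ideal R')
    [Q.IsPrime] (x : R) (hx : x ∈ maximalIdeal R) (hxQ : Subring.inclusion h x ∉ Q) :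
    (Ideal.comap (Subring.inclusion h) Q).IsPrime ∧ Ideal.comap (Subring.inclusion h) Q < maximalIdeal R :=
  ⟨Ideal.comap_isPrime _ Q, lt_of_le_of_ne (IsLocalRing.le_maximalIdeal (Ideal.comap_ne_top _ (Ideal.IsPrime.ne_top ‹_›)))
    (comap_ne_maximalIdeal_of_not_mem R R' h Q x hx hxQ)⟩

/-- **(L3b)** Let `R ≤ R₁ ≤ R'` be members, `R` local, and `x ∈ 𝔪_R` an element such that every element of `𝔪_R`
is an `R₁`-multiple of `x` (`𝔪_R · R₁ ⊆ x · R₁`: the exceptional parameter of the local blowing up of `R` along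
`𝔪_R`). Then for every PRIME `Q` of `R'`: `Q ∩ R = 𝔪_R ⟺ x ∈ Q`. OURS. [folklore] -/
theorem comap_eq_maximalIdeal_iff_mem (R R₁ R' : Subring K) [IsLocalRing R] (h : R ≤ R₁) (h₁ : R₁ ≤ R')
    (x : R) (hx : x ∈ maximalIdeal R)
    (hgen : ∀ y ∈ maximalIdeal R, ∃ z ∈ R₁, ((y : R) : K) = z * (x : K))
    (Q : Ideal R') [Q.IsPrime] :
    Ideal.comap (Subring.inclusion (h.trans h₁)) Q = maximalIdeal R ↔ Subring.inclusion (h.trans h₁) x ∈ Q := by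
  constructor
  · intro he
    rw [← Ideal.mem_comap, he]
    exact hx
  · intro hxQ
    have hle : maximalIdeal R ≤ Ideal.comap (Subring.inclusion (h.trans h₁)) Q := by
      intro y hy
      obtain ⟨z, hz, hyz⟩ := hgen y hy
      rw [Ideal.mem_comap]
      have heq : Subring.inclusion (h.trans h₁) y =
          (⟨z, h₁ hz⟩ : R') * Subring.inclusion (h.trans h₁) x :=
        Subtype.ext (by simpa using hyz)
      rw [heq]
      exact Ideal.mul_mem_left Q _ hxQ
    exact ((IsLocalRing.maximalIdeal.isMaximal R).eq_of_le
      (Ideal.comap_ne_top _ (Ideal.IsPrime.ne_top ‹_›)) hle).symm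

/-- **(L3c) over `IsLocalBlowupAlong`**: if `R₁` is the local blowing up of the local member `R` along its
maximal ideal with respect to `O` (a POINT step), then there is an exceptional parameter `x ∈ 𝔪_R`, `x ≠ 0`, such
that for every later member `R' ⊇ R₁` and every prime `Q` of `R'`: `Q ∩ R = 𝔪_R ⟺ x ∈ Q`.
[cite: NovacoskiSpivakovsky2014, Def. 2.11] -/
theorem exists_excParam_comap_eq_maximalIdeal_iff (O : ValuationSubring K) (R R₁ : Subring K) [IsLocalRing R]
    (hbl : IsLocalBlowupAlong O R (maximalIdeal R) R₁) :
    ∃ x : R, x ∈ maximalIdeal R ∧ (x : K) ≠ 0 ∧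
      ∀ (R' : Subring K) (h₁ : R₁ ≤ R') (Q : Ideal R') [Q.IsPrime],
        Ideal.comap (Subring.inclusion (hbl.isLocalBlowup.le.trans h₁)) Q = maximalIdeal R ↔
          Subring.inclusion (hbl.isLocalBlowup.le.trans h₁) x ∈ Q := by
  obtain ⟨u₀, hu₀, hgen⟩ := hbl.exists_span_singleton
  have hne : ((u₀ : R) : K) ≠ 0 := by
    have hbl' := hbl
    obtain ⟨-, u, v, hspan, hv, hv0, -, -⟩ := hbl'
    -- `u₀` generates `𝔪 R₁ ⊇ 𝔪`, and `𝔪` contains the nonzero generator `v`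
    intro h0
    have hvmem : (v : R) ∈ maximalIdeal R := hspan ▸ Ideal.subset_span hv
    obtain ⟨z, -, hz⟩ := hgen v hvmem
    rw [h0, mul_zero] at hz
    exact hv0 (Subtype.ext (by simpa using hz))
  refine ⟨u₀, hu₀, hne, fun R' h₁ Q _ => ?_⟩
  exact comap_eq_maximalIdeal_iff_mem R R₁ R' hbl.isLocalBlowup.le h₁ u₀ hu₀ hgen Q

/-- **(L3d) run form = res-L0-w41-plan-1 RULING 52 (L3)**: on a monotone tower with a POINT step at stage `i`
realised as the local blowing up along `P i = 𝔪_i` (`IsLocalBlowupAlong O (R i) (P i) (R (i+1))`), let `x` be ANY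
element of `𝔪_i` with `𝔪_i · R (i+1) ⊆ x · R (i+1)` (an exceptional parameter). If the centre `P j` of a later
stage `j > i` does NOT contain `x`, then `P j ∩ R i ≠ 𝔪_i` — a NON-maximal prime of `R i`: ancestor relations CAN
straddle the point step (the strict transform of an old germ not inside the fresh exceptional divisor). OURS.
[folklore] -/
theorem comap_ne_maximalIdeal_of_excParam_not_mem (R : ℕ → Subring K) (P : (i : ℕ) → Ideal (R i))
    [∀ i, IsLocalRing (R i)] (hmono : Monotone R) {i j : ℕ} (hij : i < j)
    (x : R i) (hx : x ∈ maximalIdeal (R i))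
    (hxQ : Subring.inclusion (hmono hij.le) x ∉ P j) :
    Ideal.comap (Subring.inclusion (hmono hij.le)) (P j) ≠ maximalIdeal (R i) :=
  comap_ne_maximalIdeal_of_not_mem (R i) (R j) (hmono hij.le) (P j) x hx hxQ

/-- **(L3e) run form, both directions**: with a point step at `i` realised by `IsLocalBlowupAlong` along
`P i = 𝔪_i`, there is an exceptional parameter `x_i ∈ 𝔪_i`, `x_i ≠ 0`, such that for every later stage `j > i`
with prime centre: `P j ∩ R i = 𝔪_i ⟺ x_i ∈ P j`. With §2: the ancestors `≤ i` of `j` die iff `x_i ∈ P j`.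
[cite: NovacoskiSpivakovsky2014, Def. 2.11] -/
theorem exists_excParam_comap_eq_maximalIdeal_iff_run (O : ValuationSubring K) (R : ℕ → Subring K)
    (P : (i : ℕ) → Ideal (R i)) [∀ i, IsLocalRing (R i)] (hmono : Monotone R) (i : ℕ)
    (hpt : IsPointStep R P i) (hbl : IsLocalBlowupAlong O (R i) (P i) (R (i + 1))) :
    ∃ x : R i, x ∈ maximalIdeal (R i) ∧ (x : K) ≠ 0 ∧
      ∀ (j : ℕ) (hij : i < j) [(P j).IsPrime],
        Ideal.comap (Subring.inclusion (hmono hij.le)) (P j) = maximalIdeal (R i) ↔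
          Subring.inclusion (hmono hij.le) x ∈ P j := by
  obtain ⟨_, hPi⟩ := hpt
  rw [hPi] at hbl
  obtain ⟨x, hx, hne, hiff⟩ := exists_excParam_comap_eq_maximalIdeal_iff O (R i) (R (i + 1)) hbl
  refine ⟨x, hx, hne, fun j hij _ => ?_⟩
  exact hiff (R j) (hmono (Nat.succ_le_of_lt hij)) (P j)

end L3

/-! ## §4 Synthesis of §2 and §3: the ancestors `≤ i` of a later positive step `j` die exactly when `x_i ∈ P j` -/

section L4

/-- **(L4a)** On a monotone tower of local members with `R i` dominating the earlier ones, let `x ∈ 𝔪_i` be an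
exceptional parameter of the (point) step at `i` (`𝔪_i · R (i+1) ⊆ x · R (i+1)`). If the prime centre `P j` of a
later stage `j > i` CONTAINS `x`, then `j` has no ancestor at or before `i` (`P j ∩ R i = 𝔪_i`, then §2). OURS.
[folklore] -/
theorem not_isAncestorStep_of_excParam_mem (R : ℕ → Subring K) (P : (i : ℕ) → Ideal (R i))
    [∀ i, IsLocalRing (R i)] (hmono : Monotone R) {i j : ℕ} (hij : i < j) [(P j).IsPrime]
    (hdom : ∀ i' (e : R i' ≤ R i), Ideal.comap (Subring.inclusion e) (maximalIdeal (R i)) = maximalIdeal (R i'))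
    (x : R i) (hx : x ∈ maximalIdeal (R i))
    (hgen : ∀ y ∈ maximalIdeal (R i), ∃ z ∈ R (i + 1), ((y : R i) : K) = z * (x : K))
    (hxP : Subring.inclusion (hmono hij.le) x ∈ P j) {i' : ℕ} (hi' : i' ≤ i) :
    ¬ IsAncestorStep R P i' j :=
  not_isAncestorStep_of_comap_eq_maximalIdeal R P (hmono hij.le) hdom
    ((comap_eq_maximalIdeal_iff_mem (R i) (R (i + 1)) (R j) (hmono (Nat.le_succ i))
      (hmono (Nat.succ_le_of_lt hij)) x hx hgen (P j)).mpr hxP) (hmono hi')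

/-- **(L4b)** Same tower; if the step at `i+1` is POSITIVE and its prime centre contains the exceptional parameter
`x` of the step at `i` (a stripping of the fresh exceptional divisor, or any centre inside it), then `i+1` is a ROOT
(birth). OURS. [folklore] -/
theorem isRootStep_succ_of_excParam_mem (R : ℕ → Subring K) (P : (i : ℕ) → Ideal (R i))
    [∀ i, IsLocalRing (R i)] (hmono : Monotone R) (i : ℕ)
    (hdom : ∀ i' (e : R i' ≤ R i), Ideal.comap (Subring.inclusion e) (maximalIdeal (R i)) = maximalIdeal (R i'))
    (hpos : IsPosStep R P (i + 1)) [(P (i + 1)).IsPrime]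
    (x : R i) (hx : x ∈ maximalIdeal (R i))
    (hgen : ∀ y ∈ maximalIdeal (R i), ∃ z ∈ R (i + 1), ((y : R i) : K) = z * (x : K))
    (hxP : Subring.inclusion (hmono (Nat.le_succ i)) x ∈ P (i + 1)) :
    IsRootStep R P (i + 1) :=
  isRootStep_succ_of_comap_eq_maximalIdeal R P hmono i hdom hpos
    ((comap_eq_maximalIdeal_iff_mem (R i) (R (i + 1)) (R (i + 1)) (hmono (Nat.le_succ i)) le_rfl
      x hx hgen (P (i + 1))).mpr hxP)

/-- **(L4c) DICHOTOMY for a later positive step** (run form over `IsLocalBlowupAlong`): with a point step at `i`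
realised by the local blowing up along `P i = 𝔪_i`, there is an exceptional parameter `x_i ∈ 𝔪_i`, `x_i ≠ 0`, such
that for every later stage `j > i` with prime centre EITHER `x_i ∈ P j` and `j` has no ancestor `≤ i`, OR
`x_i ∉ P j` and `P j ∩ R i` is a prime strictly below `𝔪_i` (so ancestors `≤ i` are possible).
[cite: NovacoskiSpivakovsky2014, Def. 2.11] -/
theorem excParam_dichotomy (O : ValuationSubring K) (R : ℕ → Subring K) (P : (i : ℕ) → Ideal (R i))
    [∀ i, IsLocalRing (R i)] (hmono : Monotone R) (i : ℕ)
    (hdom : ∀ i' (e : R i' ≤ R i), Ideal.comap (Subring.inclusion e) (maximalIdeal (R i)) = maximalIdeal (R i'))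
    (hpt : IsPointStep R P i) (hbl : IsLocalBlowupAlong O (R i) (P i) (R (i + 1))) :
    ∃ x : R i, x ∈ maximalIdeal (R i) ∧ (x : K) ≠ 0 ∧
      ∀ (j : ℕ) (hij : i < j) [(P j).IsPrime],
        (Subring.inclusion (hmono hij.le) x ∈ P j ∧ ∀ i', i' ≤ i → ¬ IsAncestorStep R P i' j) ∨
        (Subring.inclusion (hmono hij.le) x ∉ P j ∧
          (Ideal.comap (Subring.inclusion (hmono hij.le)) (P j)).IsPrime ∧
          Ideal.comap (Subring.inclusion (hmono hij.le)) (P j) < maximalIdeal (R i)) := by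
  obtain ⟨x, hx, hne, hiff⟩ := exists_excParam_comap_eq_maximalIdeal_iff_run O R P hmono i hpt hbl
  refine ⟨x, hx, hne, fun j hij _ => ?_⟩
  by_cases hxP : Subring.inclusion (hmono hij.le) x ∈ P j
  · exact Or.inl ⟨hxP, fun i' hi' =>
      not_isAncestorStep_of_comap_eq_maximalIdeal R P (hmono hij.le) hdom ((hiff j hij).mpr hxP) (hmono hi')⟩
  · exact Or.inr ⟨hxP, comap_lt_maximalIdeal_of_not_mem (R i) (R j) (hmono hij.le) (P j) x hx hxP⟩

end L4

end Summit.ResolutionOfSingularities.ResolutionOfSingularities.Theorems.SwitchingDichotomy.SigmaTopLegality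

end
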